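import Literature.Algebra.EuclideanLattices.DualGridAttemptSuccess
import HarnessLib

/-!
# The machine's attempt of MR07 Thm. 5.9 as a list program, agreeing with the `Fin`-indexed specification

Topic `Algebra/EuclideanLattices` (family `pqc`). Program layer of the bit-level `IncGDD` solver behind
`Literature.Computability.Cryptography.owfExist_of_gapSVP_worstCaseHard` (seat B): the deterministic
part of one attempt of MR07 Thm. 5.9 (`DualGridAttemptSpec.lean`: `Fvec`, `yVec`, `reduceVec`/`crep`,
`VnumOf`, `aEnt`, `cw`, `Az`, `xVec`, `uVec`) rewritten as programs on LISTS of integers — vectors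
`List ℤ`, matrices as lists of rows (`GSInverse.rowsOf`) or of columns (`GSInverse.invCols`) — which is
what the polynomial-time algebra `CodeFP` manipulates, together with the AGREEMENT lemmas: on faithful
list data (`List.ofFn`) each program returns the list of the specified vector. No estimates, no machine.

* primitives: `vecL`/`ofL`, `list_eq_of_getD`, `dotZ` (tree), `mulVecL` (rows · vector), `colCombL`
  (columns · vector = `G v` from `invCols`, or `∑ᵢ zᵢ wᵢ` for a listed family), `addL`, `smulL`, `negL`,
  `edivL`, `transposeL`, and their agreement lemmas (`dotZ_vecL`, `mulVecL_rowsOf`, `colCombL_invCols`,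
  `colCombL_ofFn`, `transposeL_ofFn`);
* the attempt: the list data `AttData`/`attDataOf` and the programs `FvecL`, `yVecL`, `reduceVecL`,
  `crepL`, `VnumL`, `aRowL`, `cwL`, `VsL`, `aRowsL`, `uVecL` with `FvecL_eq`, …, `aRowsL_eq`, and
  **`uVecL_eq`** (`uVecL` on faithful lists is `vecL (uVec …)`).

## References

* D. Micciancio, O. Regev, *Worst-case to average-case reductions based on Gaussian measures*,
  SIAM J. Comput. 37 (2007) 267–302; authors' version, Lemma 5.8 (the steps of `A_F`, p. 21),
  Thm. 5.9 (steps 2–4, p. 22).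
* S. Arora, B. Barak, *Computational Complexity: A Modern Approach*, CUP 2009, §1.3 [AroraBarak2009].
-/

noncomputable section

open scoped Classical

namespace Literature.Algebra.EuclideanLattices

open Module Matrix Finset GSInverse

namespace DualGrid

variable {n : ℕ}

/-! ### Lists of integers as vectors -/

/-- The list of a vector. [folklore] -/
def vecL (v : Fin n → ℤ) : List ℤ := List.ofFn v

/-- The vector of a list (`0` beyond its end). [folklore] -/
def ofL (n : ℕ) (l : List ℤ) : Fin n → ℤ := fun i => l.getD i 0

/-- `length_vecL` (list bookkeeping / agreement with the specification). [folklore] -/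
@[simp] theorem length_vecL (v : Fin n → ℤ) : (vecL v).length = n := by simp [vecL]

/-- `getD_vecL` (list bookkeeping / agreement with the specification). [folklore] -/
@[simp] theorem getD_vecL (v : Fin n → ℤ) (i : Fin n) : (vecL v).getD i 0 = v i := by
  rw [vecL, List.getD_eq_getElem _ _ (by simp), List.getElem_ofFn]

/-- `getD_vecL_nat` (list bookkeeping / agreement with the specification). [folklore] -/
theorem getD_vecL_nat (v : Fin n → ℤ) {i : ℕ} (hi : i < n) : (vecL v).getD i 0 = v ⟨i, hi⟩ := getD_vecL v ⟨i, hi⟩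

/-- `ofL_vecL` (list bookkeeping / agreement with the specification). [folklore] -/
@[simp] theorem ofL_vecL (v : Fin n → ℤ) : ofL n (vecL v) = v := funext fun i => getD_vecL v i

/-- Two lists of length `n` with the same `getD` at all `i < n` are equal. [folklore] -/
theorem list_eq_of_getD {l l' : List ℤ} (hl : l.length = n) (hl' : l'.length = n) (h : ∀ i : Fin n, l.getD i 0 = l'.getD i 0) :
    l = l' := by
  refine List.ext_getElem (by rw [hl, hl']) fun i h1 h2 => ?_
  have := h ⟨i, by omega⟩
  rwa [List.getD_eq_getElem _ _ h1, List.getD_eq_getElem _ _ h2] at this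

/-- A list of length `n` is `vecL` of its vector. [folklore] -/
theorem vecL_ofL {l : List ℤ} (hl : l.length = n) : vecL (ofL n l) = l :=
  list_eq_of_getD (n := n) (length_vecL _) hl fun i => by rw [getD_vecL]; rfl

/-- `rowsOf S = [vecL (S 0), …]`. [folklore] -/
theorem getD_rowsOf (S : Matrix (Fin n) (Fin n) ℤ) (j : Fin n) : (rowsOf S).getD j [] = vecL (S j) := by
  rw [List.getD_eq_getElem _ _ (by simp), getElem_rowsOf]; rfl

/-! ### Primitives -/

/-- Coordinatewise sum (to the shorter length). [folklore] -/
def addL (u v : List ℤ) : List ℤ := List.zipWith (· + ·) u v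
/-- Scalar multiple. [folklore] -/
def smulL (c : ℤ) (v : List ℤ) : List ℤ := v.map (c * ·)
/-- Negation. [folklore] -/
def negL (v : List ℤ) : List ℤ := v.map (fun x => -x)
/-- Coordinatewise integer division. [folklore] -/
def edivL (v : List ℤ) (d : ℤ) : List ℤ := v.map (· / d)
/-- Rows times vector. [folklore] -/
def mulVecL (M : List (List ℤ)) (v : List ℤ) : List ℤ := M.map fun row => dotZ row v
/-- Columns times vector: `(∑ₖ vₖ colₖ)ₜ = dotZ [colₖ[t]]ₖ v`, for `t < d`. [folklore] -/
def colCombL (d : ℕ) (cols : List (List ℤ)) (v : List ℤ) : List ℤ := (List.range d).map fun t => dotZ (cols.map fun c => c.getD t 0) v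
/-- Transpose of a `d`-column family of rows: row `t` of the result is `[rⱼ[t]]ⱼ`. [folklore] -/
def transposeL (d : ℕ) (rows : List (List ℤ)) : List (List ℤ) := (List.range d).map fun t => rows.map fun r => r.getD t 0

/-- `length_addL` (list bookkeeping / agreement with the specification). [folklore] -/
@[simp] theorem length_addL (u v : List ℤ) : (addL u v).length = min u.length v.length := by simp [addL]
/-- `length_smulL` (list bookkeeping / agreement with the specification). [folklore] -/
@[simp] theorem length_smulL (c : ℤ) (v : List ℤ) : (smulL c v).length = v.length := by simp [smulL]
/-- `length_negL` (list bookkeeping / agreement with the specification). [folklore] -/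
@[simp] theorem length_negL (v : List ℤ) : (negL v).length = v.length := by simp [negL]
/-- `length_edivL` (list bookkeeping / agreement with the specification). [folklore] -/
@[simp] theorem length_edivL (v : List ℤ) (d : ℤ) : (edivL v d).length = v.length := by simp [edivL]
/-- `length_mulVecL` (list bookkeeping / agreement with the specification). [folklore] -/
@[simp] theorem length_mulVecL (M : List (List ℤ)) (v : List ℤ) : (mulVecL M v).length = M.length := by simp [mulVecL]
/-- `length_colCombL` (list bookkeeping / agreement with the specification). [folklore] -/
@[simp] theorem length_colCombL (d : ℕ) (cols : List (List ℤ)) (v : List ℤ) : (colCombL d cols v).length = d := by simp [colCombL]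
/-- `length_transposeL` (list bookkeeping / agreement with the specification). [folklore] -/
@[simp] theorem length_transposeL (d : ℕ) (rows : List (List ℤ)) : (transposeL d rows).length = d := by simp [transposeL]

/-- `addL_vecL` (list bookkeeping / agreement with the specification). [folklore] -/
theorem addL_vecL (u v : Fin n → ℤ) : addL (vecL u) (vecL v) = vecL (u + v) :=
  list_eq_of_getD (n := n) (by simp) (by simp) fun i => by
    rw [getD_vecL, addL, List.getD_eq_getElem _ _ (by simp), List.getElem_zipWith]
    simp [vecL]

/-- `smulL_vecL` (list bookkeeping / agreement with the specification). [folklore] -/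
theorem smulL_vecL (c : ℤ) (v : Fin n → ℤ) : smulL c (vecL v) = vecL (c • v) :=
  list_eq_of_getD (n := n) (by simp) (by simp) fun i => by
    rw [getD_vecL, smulL, List.getD_eq_getElem _ _ (by simp), List.getElem_map]
    simp [vecL]

/-- `negL_vecL` (list bookkeeping / agreement with the specification). [folklore] -/
theorem negL_vecL (v : Fin n → ℤ) : negL (vecL v) = vecL (-v) :=
  list_eq_of_getD (n := n) (by simp) (by simp) fun i => by
    rw [getD_vecL, negL, List.getD_eq_getElem _ _ (by simp), List.getElem_map]
    simp [vecL]

/-- `edivL_vecL` (list bookkeeping / agreement with the specification). [folklore] -/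
theorem edivL_vecL (v : Fin n → ℤ) (d : ℤ) : edivL (vecL v) d = vecL (fun i => v i / d) :=
  list_eq_of_getD (n := n) (by simp) (by simp) fun i => by
    rw [getD_vecL, edivL, List.getD_eq_getElem _ _ (by simp), List.getElem_map]
    simp [vecL]

/-- `dotZ` of two faithful lists is the sum of products. [folklore] -/
theorem dotZ_vecL (u v : Fin n → ℤ) : dotZ (vecL u) (vecL v) = ∑ i, u i * v i := by
  rw [dotZ_eq_sum (vecL u) (vecL v) (D := n) (by simp) (by simp)]
  exact Finset.sum_congr rfl fun i _ => by rw [getD_vecL, getD_vecL]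

/-- **Rows times vector agrees with `mulVec`.** [folklore] -/
theorem mulVecL_rowsOf (M : Matrix (Fin n) (Fin n) ℤ) (v : Fin n → ℤ) : mulVecL (rowsOf M) (vecL v) = vecL (M *ᵥ v) :=
  list_eq_of_getD (n := n) (by simp) (by simp) fun i => by
    rw [getD_vecL, mulVecL, List.getD_eq_getElem _ _ (by simp), List.getElem_map, getElem_rowsOf]
    change dotZ (vecL (M ⟨i, _⟩)) (vecL v) = _
    rw [dotZ_vecL]; rfl

/-- **Columns times vector agrees with `mulVec` of the column matrix**: for `cols` with
`cols[k][t] = G t k` (`invCols` and `invMatrix`), `colCombL n cols (vecL v) = vecL (G *ᵥ v)`. [folklore] -/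
theorem colCombL_invCols (T : Matrix (Fin n) (Fin n) ℤ) (v : Fin n → ℤ) :
    colCombL n (invCols (rowsOf T)) (vecL v) = vecL (invMatrix T *ᵥ v) := by
  refine list_eq_of_getD (n := n) (by simp) (by simp) fun t => ?_
  rw [getD_vecL, colCombL, List.getD_eq_getElem _ _ (by simp), List.getElem_map, List.getElem_range]
  have hcol : ((invCols (rowsOf T)).map fun c => c.getD t 0) = vecL fun k => invMatrix T t k := by
    refine list_eq_of_getD (n := n) (by simp) (by simp) fun k => ?_
    rw [getD_vecL, List.getD_eq_getElem _ _ (by simp), List.getElem_map, getElem_invCols, invMatrix_apply]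
  rw [hcol, dotZ_vecL]; rfl

/-- **Transpose agrees**: `transposeL n [vecL (r j)]ⱼ = rowsOf (of fun t j => r j t)`. [folklore] -/
theorem transposeL_ofFn (r : Fin n → Fin n → ℤ) :
    transposeL n (List.ofFn fun j => vecL (r j)) = rowsOf (Matrix.of fun t j => r j t) := by
  refine List.ext_getElem (by simp [rowsOf]) fun t h1 h2 => ?_
  simp only [transposeL, List.getElem_map, List.getElem_range]
  rw [getElem_rowsOf]
  refine list_eq_of_getD (n := n) (by simp) (by simp) fun j => ?_
  rw [List.getD_eq_getElem _ _ (by simp), List.getElem_map, List.getElem_ofFn]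
  simp only [Fin.eta]
  rw [getD_vecL_nat _ (by simpa using h1), List.getD_eq_getElem _ _ (by simp), List.getElem_ofFn, Matrix.of_apply]

/-- **Columns/rows times vector, general form**: for a family `w : Fin m → (Fin n → ℤ)` listed as
`[vecL (w i)]ᵢ`, `colCombL n · (vecL z) = vecL (t ↦ ∑ᵢ zᵢ wᵢₜ)` (the combination `∑ᵢ zᵢ wᵢ`). [folklore] -/
theorem colCombL_ofFn {m : ℕ} (w : Fin m → Fin n → ℤ) (z : Fin m → ℤ) :
    colCombL n (List.ofFn fun i => vecL (w i)) (vecL z) = vecL (fun t => ∑ i, z i * w i t) := by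
  refine list_eq_of_getD (n := n) (by simp) (by simp) fun t => ?_
  rw [getD_vecL, colCombL, List.getD_eq_getElem _ _ (by simp), List.getElem_map, List.getElem_range]
  have hcol : ((List.ofFn fun i => vecL (w i)).map fun c => c.getD t 0) = vecL fun i => w i t := by
    refine list_eq_of_getD (n := m) (by simp) (by simp) fun i => ?_
    rw [getD_vecL, List.getD_eq_getElem _ _ (by simp), List.getElem_map, List.getElem_ofFn, getD_vecL]
  rw [hcol, dotZ_vecL]
  exact Finset.sum_congr rfl fun i _ => mul_comm _ _

/-- `rowsOf S` is the `ofFn` list of the rows. [folklore] -/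
theorem rowsOf_eq_ofFn (S : Matrix (Fin n) (Fin n) ℤ) : rowsOf S = List.ofFn fun j => vecL (S j) := rfl

/-- The sum of scaled vectors, coordinatewise. [folklore] -/
theorem sum_smul_apply {m : ℕ} (z : Fin m → ℤ) (w : Fin m → Fin n → ℤ) (t : Fin n) : (∑ i, z i • w i) t = ∑ i, z i * w i t := by
  simp [Finset.sum_apply]

/-! ### The attempt as a list program -/

/-- **The list data of an attempt**: dimension, rows of `B`, columns of `G = invMatrix B`, `Dg`, the grid
parameter `N`, rows of `S`, columns of `GT = invMatrix T_S`, `modM = dT·N·Dg`, and `q`. [folklore] -/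
structure AttData where
  /-- dimension -/
  n : ℕ
  /-- rows of `B` -/
  Brows : List (List ℤ)
  /-- columns of `G` -/
  Gcols : List (List ℤ)
  /-- `Dg` -/
  Dg : ℤ
  /-- grid parameter -/
  N : ℕ
  /-- rows of `S` -/
  Srows : List (List ℤ)
  /-- columns of `GT` -/
  GTcols : List (List ℤ)
  /-- `modM` -/
  modM : ℤ
  /-- the `SIS` modulus -/
  q : ℕ

/-- **The faithful list data** of `(B, N, S, q)`. [folklore] -/
def attDataOf (B : Matrix (Fin n) (Fin n) ℤ) (N : ℕ) (S : Matrix (Fin n) (Fin n) ℤ) (q : ℕ) : AttData :=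
  ⟨n, rowsOf B, invCols (rowsOf B), Dg B, N, rowsOf S, invCols (rowsOf (TS B S)), modM B N S, q⟩

namespace AttData

variable (d : AttData)

/-- `F = ⌊B(-K)/(N Dg)⌋`. [cite: MicciancioRegev2007, Lemma 5.7] -/
def FvecL (K : List ℤ) : List ℤ := edivL (mulVecL d.Brows (negL K)) (d.N * d.Dg)
/-- `y = -G F`. [cite: MicciancioRegev2007, Lemma 5.7 (y = r + c)] -/
def yVecL (K : List ℤ) : List ℤ := negL (colCombL d.n d.Gcols (d.FvecL K))
/-- `reduceVec K = K - N G ⌊B K/(N Dg)⌋`. [cite: MicciancioRegev2007, Lemma 5.7 (-r mod P(B))] -/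
def reduceVecL (K : List ℤ) : List ℤ := addL K (negL (smulL d.N (colCombL d.n d.Gcols (edivL (mulVecL d.Brows K) (d.N * d.Dg)))))
/-- `crep K = reduceVec (-K)`. [folklore] -/
def crepL (K : List ℤ) : List ℤ := d.reduceVecL (negL K)
/-- `V = GT (B C + N Dg κ)`. [cite: MicciancioRegev2007, Lemma 5.8 (step 3)] -/
def VnumL (C κ : List ℤ) : List ℤ := colCombL d.n d.GTcols (addL (mulVecL d.Brows C) (smulL (d.N * d.Dg) κ))
/-- The query column of a sample: `[(q Vⱼ / modM) mod q]ⱼ`. [cite: MicciancioRegev2007, Lemma 5.8 (step 3)] -/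
def aRowL (V : List ℤ) : List ℤ := (List.range d.n).map fun j => ((d.q : ℤ) * V.getD j 0 / d.modM) % d.q
/-- `c - w = -G κ + ∑ⱼ ⌊Vⱼ/modM⌋ sⱼ`. [cite: MicciancioRegev2007, Lemma 5.8 (ii)] -/
def cwL (κ V : List ℤ) : List ℤ := addL (negL (colCombL d.n d.Gcols κ)) (colCombL d.n d.Srows (edivL V d.modM))
/-- The `V`'s of the samples. [folklore] -/
def VsL (Ks κs : List (List ℤ)) : List (List ℤ) := List.zipWith (fun K κ => d.VnumL (d.crepL K) κ) Ks κs
/-- **The query rows** `aRows[i] = [aᵢⱼ]ⱼ` (column `i` of the `SIS` matrix). [cite: MicciancioRegev2007, Lemma 5.8 (step 3)] -/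
def aRowsL (Ks κs : List (List ℤ)) : List (List ℤ) := (d.VsL Ks κs).map d.aRowL
/-- **The candidate `u = x - ∑ zᵢ yᵢ`** from the samples and the oracle's answer `z`. [cite: MicciancioRegev2007, Thm. 5.9 (step 4) with Lemma 5.8 (step 5)] -/
def uVecL (Ks κs : List (List ℤ)) (z : List ℤ) : List ℤ :=
  addL (addL (colCombL d.n (List.zipWith d.cwL κs (d.VsL Ks κs)) z)
      (colCombL d.n d.Srows (edivL (colCombL d.n (d.aRowsL Ks κs) z) d.q)))
    (negL (colCombL d.n (Ks.map d.yVecL) z))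

end AttData

/-! ### Agreement with the specification -/

section Agreement

variable (B : Matrix (Fin n) (Fin n) ℤ) (N : ℕ) (S : Matrix (Fin n) (Fin n) ℤ) (q : ℕ)

/-- `FvecL_eq` (list bookkeeping / agreement with the specification). [folklore] -/
theorem FvecL_eq (K : Fin n → ℤ) : (attDataOf B N S q).FvecL (vecL K) = vecL (Fvec B N K) := by
  simp only [AttData.FvecL, attDataOf, negL_vecL, mulVecL_rowsOf, edivL_vecL]; rfl

/-- `yVecL_eq` (list bookkeeping / agreement with the specification). [folklore] -/
theorem yVecL_eq (K : Fin n → ℤ) : (attDataOf B N S q).yVecL (vecL K) = vecL (yVec B N K) := by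
  rw [AttData.yVecL, FvecL_eq]; simp only [attDataOf, colCombL_invCols, negL_vecL, yVec, G]

/-- `reduceVecL_eq` (list bookkeeping / agreement with the specification). [folklore] -/
theorem reduceVecL_eq (K : Fin n → ℤ) : (attDataOf B N S q).reduceVecL (vecL K) = vecL (reduceVec B N K) := by
  simp only [AttData.reduceVecL, attDataOf, mulVecL_rowsOf, edivL_vecL, colCombL_invCols, smulL_vecL, negL_vecL, addL_vecL,
    reduceVec, G, sub_eq_add_neg, natCast_zsmul]

/-- `crepL_eq` (list bookkeeping / agreement with the specification). [folklore] -/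
theorem crepL_eq (K : Fin n → ℤ) : (attDataOf B N S q).crepL (vecL K) = vecL (crep B N K) := by
  rw [AttData.crepL, negL_vecL, reduceVecL_eq]; rfl

/-- `VnumL_eq` (list bookkeeping / agreement with the specification). [folklore] -/
theorem VnumL_eq (C κ : Fin n → ℤ) : (attDataOf B N S q).VnumL (vecL C) (vecL κ) = vecL (VnumOf B N S C κ) := by
  simp only [AttData.VnumL, attDataOf, mulVecL_rowsOf, smulL_vecL, addL_vecL, colCombL_invCols, VnumOf, GT]

/-- `aRowL_eq` (list bookkeeping / agreement with the specification). [folklore] -/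
theorem aRowL_eq (K κ : Fin n → ℤ) :
    (attDataOf B N S q).aRowL (vecL (Vnum B N S K κ)) = vecL (fun j => aEnt B N S q K κ j) := by
  refine list_eq_of_getD (n := n) (by simp [AttData.aRowL, attDataOf]) (by simp) fun j => ?_
  rw [getD_vecL, AttData.aRowL, List.getD_eq_getElem _ _ (by simp [attDataOf]), List.getElem_map, List.getElem_range, getD_vecL_nat _ j.2]
  rfl

/-- `cwL_eq` (list bookkeeping / agreement with the specification). [folklore] -/
theorem cwL_eq (K κ : Fin n → ℤ) :
    (attDataOf B N S q).cwL (vecL κ) (vecL (Vnum B N S K κ)) = vecL (cw B N S K κ) := by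
  rw [AttData.cwL]
  simp only [attDataOf]
  rw [colCombL_invCols, edivL_vecL, rowsOf_eq_ofFn S, colCombL_ofFn, negL_vecL, addL_vecL, cw]
  congr 1
  funext t
  simp only [Pi.add_apply, Pi.neg_apply, sum_smul_apply, flo, G]

variable {m : ℕ}

/-- `VsL_eq` (list bookkeeping / agreement with the specification). [folklore] -/
theorem VsL_eq (Kf κf : Fin m → Fin n → ℤ) :
    (attDataOf B N S q).VsL (List.ofFn fun i => vecL (Kf i)) (List.ofFn fun i => vecL (κf i)) =
      List.ofFn fun i => vecL (Vnum B N S (Kf i) (κf i)) := by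
  refine List.ext_getElem (by simp [AttData.VsL]) fun i h1 h2 => ?_
  simp only [AttData.VsL, List.getElem_zipWith, List.getElem_ofFn]
  rw [crepL_eq, VnumL_eq]

/-- `aRowsL_eq` (list bookkeeping / agreement with the specification). [folklore] -/
theorem aRowsL_eq (Kf κf : Fin m → Fin n → ℤ) :
    (attDataOf B N S q).aRowsL (List.ofFn fun i => vecL (Kf i)) (List.ofFn fun i => vecL (κf i)) =
      List.ofFn fun i => vecL fun j => aEnt B N S q (Kf i) (κf i) j := by
  rw [AttData.aRowsL, VsL_eq, List.map_ofFn]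
  congr 1; funext i; exact aRowL_eq B N S q (Kf i) (κf i)

/-- **The attempt program computes `uVec`.** [cite: MicciancioRegev2007, Thm. 5.9 (steps 2–4)] -/
theorem uVecL_eq (Kf κf : Fin m → Fin n → ℤ) (z : Fin m → ℤ) :
    (attDataOf B N S q).uVecL (List.ofFn fun i => vecL (Kf i)) (List.ofFn fun i => vecL (κf i)) (vecL z) =
      vecL (uVec B N S q Kf κf z) := by
  have hcws : List.zipWith (attDataOf B N S q).cwL (List.ofFn fun i => vecL (κf i))
      ((attDataOf B N S q).VsL (List.ofFn fun i => vecL (Kf i)) (List.ofFn fun i => vecL (κf i))) =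
      List.ofFn fun i => vecL (cw B N S (Kf i) (κf i)) := by
    rw [VsL_eq]
    refine List.ext_getElem (by simp) fun i h1 h2 => ?_
    simp only [List.getElem_zipWith, List.getElem_ofFn]
    exact cwL_eq B N S q (Kf _) (κf _)
  have hys : (List.ofFn fun i => vecL (Kf i)).map (attDataOf B N S q).yVecL = List.ofFn fun i => vecL (yVec B N (Kf i)) := by
    rw [List.map_ofFn]; congr 1; funext i; exact yVecL_eq B N S q (Kf i)
  rw [AttData.uVecL, hcws, aRowsL_eq, hys]
  simp only [attDataOf]
  rw [colCombL_ofFn, colCombL_ofFn, colCombL_ofFn, edivL_vecL, rowsOf_eq_ofFn S, colCombL_ofFn, addL_vecL, negL_vecL, addL_vecL]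
  congr 1
  funext t
  simp only [uVec, xVec, Az, Pi.add_apply, Pi.neg_apply, Pi.sub_apply, sum_smul_apply]
  ring

end Agreement

end DualGrid

end Literature.Algebra.EuclideanLattices

end
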